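import Summits.Ventures.WeilGRH.KeySectionToTest
import HarnessLib

/-!
# GRH arm (rh-explicit, venture WeilGRH): the ALL-TRIVIAL key is a universal minorant — `Re Q_χ(g) ≥ T^{(a)}(|g|)`

Cell `rh-explicit`, WEIL TRACK (lit/typing seat weil-grh-5; the window-function half of weil-grh-2 gen5's
MINORANT lemma `HOME/rh-explicit-weil-grh-2/MINORANT.md`, typed in the section/window language of
`KeyMarkovForm.lean` … `KeySectionToTest.lean`).

For a window function `u` on `[-b, b]` the Markov key form has the REDUCED shape
(`keyMarkovForm_eq_reduced_of_isWindowFunction`)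
`E_{a,L,v}(u) = ∫₀^∞ ρ_a(s) D_s(u) ds − C_{a,L}‖u‖₂² − Σ_{log n < 2c} (Λ(n)/√n)·2 Re(v(n)(u⋆ũ)(log n))`,
with `D_s(u) = ∫|u(x+s) − u(x)|² dx`, `(u⋆ũ)(s) = ∫ u(x+s) conj u(x) dx`, `ρ_a ≥ 0`, `Λ(n)/√n ≥ 0`, and a constant `C_{a,L}`
that does NOT depend on the data `v`.  Two pointwise triangle inequalities,
* `| |u(x+s)| − |u(x)| | ≤ |u(x+s) − u(x)|` (so `D_s(|u|) ≤ D_s(u)`: the modulus is a contraction of every increment —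
  the first Beurling–Deny criterion for the jump form `∫ρ_a D_s ds`), and
* `|(u⋆ũ)(s)| ≤ ∫|u(x+s)||u(x)| dx = (|u|⋆|ũ|)(s)` (so `Re(v(n)(u⋆ũ)(log n)) ≤ (|u|⋆|ũ|)(log n)` whenever `|v(n)| ≤ 1`),
give the **minorant** (`keyMarkovForm_norm_le`):

  `E_{a,L,1}(|u|) ≤ E_{a,L,v}(u)`  for every datum with `|v(n)| ≤ 1`, every level `L`, every window —

the all-trivial key `v ≡ 1` of the same parity and level, evaluated at `|u|` (again a window function on `[-b, b]`,
`isWindowFunction_norm`, with `‖|u|‖₂ = ‖u‖₂`), is below every key form.  Consequences for Dirichlet characters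
(`|χ(n)| ≤ 1` at EVERY `n`, including `p ∣ q` where `χ(n) = 0`; the level is monotone, `keyMarkovForm_eq_add_norm`):
* `keyMarkovForm_allTrivial_le_re_weilQuadraticChar`: `q ≠ 1`, `g` a test function on `[-t, t]`, `L₀ ≤ log q` ⇒
  `E_{a_χ,L₀,1}(|g|) ≤ Re Q_χ(g)`;
* ★ `weilPositivityOnChar_of_allTrivial_window_nonneg`: if the all-trivial key form of parity `a` and level `L₀` is
  `≥ 0` at every non-negative real window function on `[-t, t]`, then `WeilPositivityOnChar χ t` for EVERY character
  `χ mod q`, `q ≠ 1`, of parity `a` with `log q ≥ L₀` — one statement about ONE form, uniformly in the character;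
* ★ `weilPositivityOnChar_of_weilPositivityOnKey_allTrivial`: test-function positivity of the pseudo-key
  `WeilPositivityOnKey a L₀ 1 N` (what a certificate at the all-trivial key proves) ⇒ the same conclusion on every
  window `t < log(N+1)/2` (through the section → test transfer `not_weilPositivityOnKey_of_isWindowFunction`).
What is NOT here: the conclusion AT `t = log(N+1)/2` from test-function positivity of the pseudo-key (the transfer
smooths, which enlarges the support), and the parity mixing (the even pseudo-key below odd characters).
Everything is proved; no definitions; no named facts; RH/GRH-free.  Sources: the form [Weil1952FormulesExplicites,
(11) pp. 261–262; Bombieri2000Weil, Thm 2 p. 193]; the contraction property of jump Dirichlet forms [folklore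
(Beurling–Deny)]; the minorant statement: weil-grh-2 gen5, MINORANT.md (2026-08-23).
-/

set_option autoImplicit false

noncomputable section

open Complex Filter Set MeasureTheory

open scoped Real Topology ComplexConjugate ArithmeticFunction.vonMangoldt

namespace Summit.Ventures.WeilGRH

open Literature.NumberTheory.LFunctions
open Summit.RiemannHypothesis.RiemannHypothesis.Theorems.WeilFormatC

variable {b : ℝ} {u : ℝ → ℂ}

/-! ## The modulus of a window function; test functions are window functions -/

/-- `|u|` (valued in `ℂ`) of a window function on `[-b, b]` is a window function on `[-b, b]`
(`| |u(y)| − |u(x)| | ≤ |u(y) − u(x)|`). [folklore] -/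
theorem isWindowFunction_norm (hu : IsWindowFunction b u) : IsWindowFunction b (fun x ↦ ((‖u x‖ : ℝ) : ℂ)) := by
  obtain ⟨S, hS⟩ := hu.bounded
  obtain ⟨K, hK⟩ := hu.lipschitz
  refine ⟨Complex.measurable_ofReal.comp hu.measurable.norm, fun x hx ↦ ?_, ⟨S, fun x ↦ ?_⟩,
    ⟨K, fun x y hx hy ↦ ?_⟩⟩
  · simp only [hu.eq_zero x hx, norm_zero, Complex.ofReal_zero]
  · rw [Complex.norm_real, norm_norm]
    exact hS x
  · rw [← Complex.ofReal_sub, Complex.norm_real, Real.norm_eq_abs]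
    exact (abs_norm_sub_norm_le _ _).trans (hK x y hx hy)

/-- A test function supported in `[-t, t]` is a window function on `[-t, t]` (bounded with a bounded continuous
derivative, hence Lipschitz). [folklore] -/
theorem isWindowFunction_of_isWeilTest {g : ℝ → ℂ} (hg : IsWeilTest g) {t : ℝ} (hsupp : tsupport g ⊆ Icc (-t) t) :
    IsWindowFunction t g := by
  have hd : Differentiable ℝ g := hg.1.differentiable (by simp)
  have hc' : Continuous (deriv g) := hg.1.continuous_deriv (by simp)
  obtain ⟨C, hC⟩ := hg.1.continuous.bounded_above_of_compact_support hg.2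
  obtain ⟨K, hK⟩ := hc'.bounded_above_of_compact_support hg.2.deriv
  refine ⟨hg.1.continuous.measurable, fun x hx ↦ image_eq_zero_of_notMem_tsupport fun h ↦ hx (hsupp h), ⟨C, hC⟩,
    ⟨K, fun x y _ _ ↦ ?_⟩⟩
  rw [← Real.norm_eq_abs]
  exact convex_univ.norm_image_sub_le_of_norm_deriv_le (fun z _ ↦ hd z) (fun z _ ↦ hK z) (mem_univ x) (mem_univ y)

/-! ## The two triangle inequalities -/

/-- **`D_s(|u|) ≤ D_s(u)`**: the modulus contracts every increment (first Beurling–Deny criterion; pointwise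
`| |u(x+s)| − |u(x)| |² ≤ |u(x+s) − u(x)|²`). [folklore] -/
theorem weilIncrement_norm_le (hu : IsWindowFunction b u) (s : ℝ) :
    weilIncrement (fun x ↦ ((‖u x‖ : ℝ) : ℂ)) s ≤ weilIncrement u s := by
  unfold weilIncrement
  refine integral_mono_of_nonneg (Eventually.of_forall fun x ↦ sq_nonneg _) (integrable_norm_sq_shift_sub hu s)
    (Eventually.of_forall fun x ↦ ?_)
  dsimp only
  rw [← Complex.ofReal_sub, Complex.norm_real, Real.norm_eq_abs]
  exact pow_le_pow_left₀ (abs_nonneg _) (abs_norm_sub_norm_le _ _) 2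

/-- The autocorrelation of `|u|` is the real pairing `∫ |u(x+s)| |u(x)| dx`. [folklore] -/
theorem weilConv_weilReflect_norm_eq (u : ℝ → ℂ) (s : ℝ) :
    weilConv (fun x ↦ ((‖u x‖ : ℝ) : ℂ)) (weilReflect fun x ↦ ((‖u x‖ : ℝ) : ℂ)) s =
      ((∫ x : ℝ, ‖u (x + s)‖ * ‖u x‖ : ℝ) : ℂ) := by
  rw [weilConv_weilReflect_eq_integral_shift, ← integral_complex_ofReal]
  refine integral_congr_ae (Eventually.of_forall fun x ↦ ?_)
  simp only [Complex.conj_ofReal, Complex.ofReal_mul]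

/-- **`|(u ⋆ ũ)(s)| ≤ (|u| ⋆ |ũ|)(s)`** `= ∫ |u(x+s)| |u(x)| dx` (triangle inequality for the shift pairing). [folklore] -/
theorem norm_weilConv_weilReflect_le_norm (u : ℝ → ℂ) (s : ℝ) :
    ‖weilConv u (weilReflect u) s‖ ≤
      (weilConv (fun x ↦ ((‖u x‖ : ℝ) : ℂ)) (weilReflect fun x ↦ ((‖u x‖ : ℝ) : ℂ)) s).re := by
  rw [weilConv_weilReflect_norm_eq, Complex.ofReal_re, weilConv_weilReflect_eq_integral_shift]
  refine (norm_integral_le_integral_norm _).trans (le_of_eq (integral_congr_ae (Eventually.of_forall fun x ↦ ?_)))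
  simp only [norm_mul, Complex.norm_conj]

/-- `Re(ω (u ⋆ ũ)(s)) ≤ (|u| ⋆ |ũ|)(s)` for `|ω| ≤ 1` — the value `ω = 1` at `|u|` is the worst case. [folklore] -/
theorem re_mul_weilConv_weilReflect_le_norm (u : ℝ → ℂ) (s : ℝ) {ω : ℂ} (hω : ‖ω‖ ≤ 1) :
    (ω * weilConv u (weilReflect u) s).re ≤
      ((1 : ℂ) * weilConv (fun x ↦ ((‖u x‖ : ℝ) : ℂ)) (weilReflect fun x ↦ ((‖u x‖ : ℝ) : ℂ)) s).re := by
  rw [one_mul]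
  refine (Complex.re_le_norm _).trans ?_
  rw [norm_mul]
  exact (mul_le_of_le_one_left (norm_nonneg _) hω).trans (norm_weilConv_weilReflect_le_norm u s)

/-- `‖|u|‖₂² = ‖u‖₂²`. [folklore] -/
theorem integral_norm_sq_norm (u : ℝ → ℂ) :
    (∫ x : ℝ, ‖(((‖u x‖ : ℝ) : ℂ))‖ ^ 2) = ∫ x : ℝ, ‖u x‖ ^ 2 := by
  refine integral_congr_ae (Eventually.of_forall fun x ↦ ?_)
  simp only [Complex.norm_real, norm_norm]

/-! ## The minorant -/

/-- **The all-trivial key is a universal minorant of the key forms (window language).**  For a window function `u`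
on `[-b, b]` (`b ≥ 0`), every parity `a`, level `L`, window parameter `c` and every datum with `|v(n)| ≤ 1`:
`keyMarkovForm a L 1 c |u| ≤ keyMarkovForm a L v c u` — the archimedean jump form contracts under `u ↦ |u|`
(`ρ_a ≥ 0`, `D_s(|u|) ≤ D_s(u)`), the constant term sees only `‖u‖₂ = ‖|u|‖₂`, and at every prime power
`Re(v(n)(u⋆ũ)(log n)) ≤ (|u|⋆|ũ|)(log n)` enters with the sign `−2Λ(n)/√n ≤ 0`.
(Beurling–Deny contraction; statement: weil-grh-2 gen5 MINORANT.md.) [cite: Bombieri2000Weil, Thm 2 (p. 193)] -/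
theorem keyMarkovForm_norm_le (hb : 0 ≤ b) (hu : IsWindowFunction b u) (a : ℕ) (L : ℝ) {v : ℕ → ℂ}
    (hv : ∀ n, ‖v n‖ ≤ 1) (c : ℝ) :
    keyMarkovForm a L (fun _ ↦ 1) c (fun x ↦ ((‖u x‖ : ℝ) : ℂ)) ≤ keyMarkovForm a L v c u := by
  have hn := isWindowFunction_norm hu
  rw [keyMarkovForm_eq_reduced_of_isWindowFunction hn a L _ c, keyMarkovForm_eq_reduced_of_isWindowFunction hu a L v c,
    integral_norm_sq_norm]
  have harch : (∫ t in Ioi (0 : ℝ), weilArchDensityPar a t * weilIncrement (fun x ↦ ((‖u x‖ : ℝ) : ℂ)) t) ≤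
      ∫ t in Ioi (0 : ℝ), weilArchDensityPar a t * weilIncrement u t := by
    refine integral_mono_of_nonneg ?_ (integrableOn_arch_of_isWindowFunction hb hu a) ?_
    · refine (ae_restrict_iff' measurableSet_Ioi).2 (Eventually.of_forall fun t ht ↦ ?_)
      exact mul_nonneg (weilArchDensityPar_nonneg_le a ht).1 (weilIncrement_nonneg _ _)
    · refine (ae_restrict_iff' measurableSet_Ioi).2 (Eventually.of_forall fun t ht ↦ ?_)
      exact mul_le_mul_of_nonneg_left (weilIncrement_norm_le hu t) (weilArchDensityPar_nonneg_le a ht).1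
  have hprime : ∑ n ∈ weilPrimeIndex c, (Λ n : ℝ) / Real.sqrt n *
        (2 * (v n * weilConv u (weilReflect u) (Real.log n)).re) ≤
      ∑ n ∈ weilPrimeIndex c, (Λ n : ℝ) / Real.sqrt n *
        (2 * ((1 : ℂ) * weilConv (fun x ↦ ((‖u x‖ : ℝ) : ℂ)) (weilReflect fun x ↦ ((‖u x‖ : ℝ) : ℂ))
          (Real.log n)).re) := by
    refine Finset.sum_le_sum fun n _ ↦
      mul_le_mul_of_nonneg_left ?_ (div_nonneg ArithmeticFunction.vonMangoldt_nonneg (Real.sqrt_nonneg _))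
    exact mul_le_mul_of_nonneg_left (re_mul_weilConv_weilReflect_le_norm u _ (hv n)) zero_le_two
  linarith

/-- The minorant with a LOWER level: `L₀ ≤ L` ⇒ `keyMarkovForm a L₀ 1 c |u| ≤ keyMarkovForm a L v c u`. [folklore] -/
theorem keyMarkovForm_norm_le_of_level_le (hb : 0 ≤ b) (hu : IsWindowFunction b u) (a : ℕ) {L₀ L : ℝ}
    (hL : L₀ ≤ L) {v : ℕ → ℂ} (hv : ∀ n, ‖v n‖ ≤ 1) (c : ℝ) :
    keyMarkovForm a L₀ (fun _ ↦ 1) c (fun x ↦ ((‖u x‖ : ℝ) : ℂ)) ≤ keyMarkovForm a L v c u := by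
  have h1 := keyMarkovForm_norm_le hb hu a L hv c
  rw [keyMarkovForm_eq_add_norm a L₀ L (fun _ ↦ (1 : ℂ)) c] at h1
  have h2 : 0 ≤ (L - L₀) * ∫ x : ℝ, ‖(((‖u x‖ : ℝ) : ℂ))‖ ^ 2 :=
    mul_nonneg (by linarith) (integral_nonneg fun x ↦ sq_nonneg _)
  linarith

/-! ## Consequences for Dirichlet characters -/

variable {q : ℕ}

/-- **`T^{(a_χ)}_{L₀}(|g|) ≤ Re Q_χ(g)`**: for `q ≠ 1`, a test function `g` on `[-t, t]` (`t ≥ 0`) and any level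
`L₀ ≤ log q`, the all-trivial key form of parity `a_χ` and level `L₀` at `|g|` is below `Re Q_χ(g)` (`|χ(n)| ≤ 1` at
every `n`, including `p ∣ q`; statement: weil-grh-2 gen5 MINORANT.md). [cite: Weil1952FormulesExplicites, (11) pp. 261–262] -/
theorem keyMarkovForm_allTrivial_le_re_weilQuadraticChar (hq : q ≠ 1) (χ : DirichletCharacter ℂ q) {g : ℝ → ℂ}
    (hg : IsWeilTest g) {t : ℝ} (ht : 0 ≤ t) (hsupp : tsupport g ⊆ Icc (-t) t) {L₀ : ℝ} (hL : L₀ ≤ Real.log q) :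
    keyMarkovForm (charParity χ) L₀ (fun _ ↦ 1) t (fun x ↦ ((‖g x‖ : ℝ) : ℂ)) ≤ (weilQuadraticChar χ g).re := by
  rw [re_weilQuadraticChar_eq_keyMarkovForm hq χ hg hsupp]
  exact keyMarkovForm_norm_le_of_level_le ht (isWindowFunction_of_isWeilTest hg hsupp) (charParity χ) hL
    (fun n ↦ χ.norm_le_one _) t

/-- ★ **Window non-negativity of the all-trivial key ⇒ Weil positivity of EVERY character of that parity above
that level.**  If the all-trivial key form of parity `a` and level `L₀` is `≥ 0` at every non-negative real window
function on `[-t, t]` (`t ≥ 0`), then `WeilPositivityOnChar χ t` for every Dirichlet character `χ mod q`, `q ≠ 1`,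
with `charParity χ = a` and `L₀ ≤ log q` — uniformly in the character's values.
(Statement: weil-grh-2 gen5, MINORANT.md, 2026-08-23.) [folklore] -/
theorem weilPositivityOnChar_of_allTrivial_window_nonneg {a : ℕ} {L₀ t : ℝ} (ht : 0 ≤ t)
    (H : ∀ w : ℝ → ℝ, (∀ x, 0 ≤ w x) → IsWindowFunction t (fun x ↦ (w x : ℂ)) →
      0 ≤ keyMarkovForm a L₀ (fun _ ↦ 1) t (fun x ↦ (w x : ℂ)))
    (hq : q ≠ 1) (χ : DirichletCharacter ℂ q) (hpar : charParity χ = a) (hL : L₀ ≤ Real.log q) :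
    WeilPositivityOnChar χ t := by
  intro g hg hsupp
  have h := keyMarkovForm_allTrivial_le_re_weilQuadraticChar hq χ hg ht hsupp hL
  rw [hpar] at h
  exact (H (fun x ↦ ‖g x‖) (fun x ↦ norm_nonneg _)
    (isWindowFunction_norm (isWindowFunction_of_isWeilTest hg hsupp))).trans h

/-- **Test-function positivity of a key ⇒ non-negativity of its window form on every smaller window** (the
section → test transfer of `KeySectionToTest.lean`, contraposed). [folklore] -/
theorem keyMarkovForm_nonneg_of_weilPositivityOnKey {a : ℕ} (ha : a ≤ 1) {L : ℝ} {v : ℕ → ℂ} {N : ℕ}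
    (hpos : WeilPositivityOnKey a L v N) {t : ℝ} (ht : 0 ≤ t) (htN : t < Real.log ((N : ℝ) + 1) / 2)
    {w : ℝ → ℂ} (hw : IsWindowFunction t w) : 0 ≤ keyMarkovForm a L v t w := by
  by_contra hneg
  rw [← keyMarkovForm_window_eq_of_isWindowFunction hw htN.le] at hneg
  exact not_weilPositivityOnKey_of_isWindowFunction ht hw htN ha L v (not_le.1 hneg) hpos

/-- ★★ **ONE certificate at the pseudo-key, EVERY character.**  Test-function positivity of the all-trivial key
`WeilPositivityOnKey a L₀ 1 N` (`a ≤ 1`) implies `WeilPositivityOnChar χ t` for every window `0 ≤ t < log(N+1)/2`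
and every Dirichlet character `χ mod q`, `q ≠ 1`, of parity `a` with `L₀ ≤ log q`.
(Statement: weil-grh-2 gen5, MINORANT.md, 2026-08-23.) [folklore] -/
theorem weilPositivityOnChar_of_weilPositivityOnKey_allTrivial {a : ℕ} (ha : a ≤ 1) {L₀ : ℝ} {N : ℕ}
    (hpos : WeilPositivityOnKey a L₀ (fun _ ↦ 1) N) {t : ℝ} (ht : 0 ≤ t) (htN : t < Real.log ((N : ℝ) + 1) / 2)
    (hq : q ≠ 1) (χ : DirichletCharacter ℂ q) (hpar : charParity χ = a) (hL : L₀ ≤ Real.log q) :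
    WeilPositivityOnChar χ t :=
  weilPositivityOnChar_of_allTrivial_window_nonneg ht
    (fun _ _ hw ↦ keyMarkovForm_nonneg_of_weilPositivityOnKey ha hpos ht htN hw) hq χ hpar hL

/-- The same with the pseudo-key taken from an actual character `χ₀ mod q₀` whose values are replaced by `1`:
positivity of the key `(charParity χ₀, log q₀, 1)` on `[−log(N+1)/2, log(N+1)/2]` gives every character of the same
parity and modulus `q ≥ q₀` on every window `t < log(N+1)/2`. [folklore] -/
theorem weilPositivityOnChar_of_weilPositivityOnKey_allTrivial_mod {q₀ : ℕ} (χ₀ : DirichletCharacter ℂ q₀) {N : ℕ}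
    (hpos : WeilPositivityOnKey (charParity χ₀) (Real.log q₀) (fun _ ↦ 1) N) {t : ℝ} (ht : 0 ≤ t)
    (htN : t < Real.log ((N : ℝ) + 1) / 2) (hq : q ≠ 1) (χ : DirichletCharacter ℂ q)
    (hpar : charParity χ = charParity χ₀) (hqq : q₀ ≤ q) (hq₀ : q₀ ≠ 0) : WeilPositivityOnChar χ t :=
  weilPositivityOnChar_of_weilPositivityOnKey_allTrivial (charParity_le_one χ₀) hpos ht htN hq χ hpar
    (Real.log_le_log (by exact_mod_cast Nat.pos_of_ne_zero hq₀) (by exact_mod_cast hqq))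

end Summit.Ventures.WeilGRH

end
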